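import Summits.QuantumFields.YangMills.Theorems.BalabanUVNodesN15KingModelJetLettersColour
import Summits.QuantumFields.YangMills.Theorems.BalabanUVNodesN15TorusReflections
import HarnessLib

/-!
# BalabanUVNodes ∕ N15 — THE KING-MODEL RUNG, PROGRAMME Y (the dressed SOURCE-DIVERGENCE entry of the King jet), FILE 66:
# THE BLOCK-FACE REFLECTION DICTIONARY FOR KING's RUNG — `σ_κ∘(A₀⁻¹N∇*_κ)∘σ_κ = A₀⁻¹N∇_κ` (the forward source difference), the pairing, the blocks and
# the block averages commute with `σ`, and block majorants ∕ η-defects are transported by conjugation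

WHO ∕ WHEN.  Cell `pub-ymgap`, seat `pub-ymgap-dag-n15-d` (R134, N15 NE2 s3 = King-model rung, g22); `--kind proof --supports stmt-QuantumFields-27366 --as helper`
(K3⁸; count-neutral).  THEOREMS ONLY (0 `def`: the reflections are dag-n15-a N-Ia's `torRefl`, written out on the coloured carriers as `fun p => (torRefl p.1, p.2)`).
Over dag-n15-a N-Ia `…N15TorusReflections` (`torRefl`, `torRefl_torRefl`, `torRefl_add∕sub`, `torNeg`), King's `val_blockOf` (`MinimizerTowerBridge`), dag-n15-b∕-a
`kingPr_val`, the η-defect calculus `T4EtaRateDefect.idef` ∕ `T4EtaRateCoeffDefect.pull∕blockAvg` BY NAME; nothing in the tree is modified.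

WHY (this seat's ARCHITECTURE NOTE «ENTRY 2 LIVE BY PARTS», pub-ymgap INBOX l.43300).  The by-parts fixed point of the dressed third entry `Y = X∘N∇*_κ` of the King jet
contains the operators `S̃_μ := A₀⁻¹∘N(s_μ − 1)` (FORWARD source difference — the lattice Leibniz rule `M_a∘N∇_μ = N∇_μ∘M_{a(·−e_μ)} − M_{N∇_μ a(·−e_μ)}` puts the
species' forward difference on the source side of `A₀⁻¹`), the mirror images of the rung's `kingSOp_μ = A₀⁻¹∘N(s_μ⁻¹ − 1)`.  Their plain rows, their two-grid η-defect
and their cell-oscillation row (FILE 65) are NOT derivable from `kingSOp`'s by composing with shifts (the fine one-step shift and the coarse one-step shift do not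
intertwine through King's pairing: the shift defect is not termwise small), but they ARE the `kingSOp` rows CONJUGATED by the block-face reflection `σ_μ` of
dag-n15-a's programme N: `A₀` is `σ`-invariant (the Laplacian's stencil is `σ`-symmetric, `Q*Q` sees only «same block», and blocks go to blocks), King's pairing
`kingPrV` and the block averages commute with `σ`, and `σ` is an isometry of the block torus — so every `HasMaj` row transports.  THIS FILE is that dictionary;
FILE 67 reads the three `S̃` rows off it.

WHAT.  §1 `val_torRefl_same`, `refl_div_arith`, ★ `floorMap_torRefl` (any `⌊·∕R⌋`-map commutes with `σ`), `blockOf_torRefl`, `kingPr_torRefl`, `kingPrV_reflC`,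
`tdistT_torRefl` (`σ` is an isometry of the block torus); §2 `lapF_torRefl`, `blockProj_torRefl`, `fineOp_torRefl` (`A₀(σx, σy) = A₀(x, y)`), `fineOp_submatrix_torRefl`,
`fineOp_inv_submatrix_torRefl`, `fineOp_inv_torRefl`, `pull_torRefl_comp_mulVecLin_comp`, `pull_torRefl_comp_kingGOp_comp` (`σ∘A₀⁻¹∘σ = A₀⁻¹`),
`pull_torRefl_comp_pull_sub_comp`, ★ `pull_torRefl_comp_kingSOp_comp` (`σ_κ∘kingSOp_κ∘σ_κ = A₀⁻¹∘N(s_κ − 1)`), the coloured lifts `reflC_comp_tensorId_comp`,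
★ `reflC_comp_tensorId_kingSOp_comp`; §3 ★★ `hasMaj_reflConj` (a block majorant between sharp block sizes is invariant under conjugation by block-compatible
involutions), `idef_reflConj` (`𝔇(φ₂′^*A′φ₁′^*, φ₂^*Āφ₁^*) = φ₂′^*∘𝔇(A′, Ā)∘φ₁^*`), `pull_comp_mulOp`, `blockAvg_comp_refl` (`blockAvg_π(c′∘φ′) = (blockAvg_π c′)∘φ`),
`pull_comp_idef_mulOp` (`φ′^*∘𝔇_π(M_{c′}, M_{c̄}) = 𝔇_π(M_{c′∘φ′}, M_{c̄∘φ})∘φ^*`).  The three `S̃` rows (plain, two-grid defect, cell oscillation) are read off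
in FILE 67.

HONEST FRAMING ∕ LIMITS.  Finite-torus index algebra + King's `A = 0` MODEL operators (template literature [King1986] (2.13) p.653, (4.1)–(4.5) p.670); no estimate is
proved here; NOT Bałaban's covariant `G(U)`; [Balaban1984PropagatorsII] (2.37) p.229 (reflections) ∕ [Balaban1985BackgroundPropagators] (3.42) p.397 cited as SHAPE only.
NE2⁺ NOT PRINTED ∕ NOT proved; no statement of record touched; N15 NOT discharged; K3⁸ OPEN; counts UNMOVED (typed 28∕28 · discharged 5∕27); one finite torus per index
— NOT ℝ⁴ ∕ infinite volume ∕ OS ∕ mass gap ∕ Clay.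
-/

noncomputable section

open scoped BigOperators Matrix
open Finset

namespace Summit.QuantumFields.YangMills.BalabanUVNodes.N15.KingModel.SrcDiv

open Literature.MathematicalPhysics.QuantumFieldTheory.Balaban1983to89
open Literature.MathematicalPhysics.QuantumFieldTheory.Balaban1983to89.B11SectG (BlockNorm HasMaj)
open Literature.MathematicalPhysics.QuantumFieldTheory.Balaban1983to89.B11AxialTransport190 (abs_le_loc_ofBlocks loc_ofBlocks_le)
open Literature.MathematicalPhysics.QuantumFieldTheory.Balaban1983to89.T4EtaRateDefect (idef idef_apply)
open Literature.MathematicalPhysics.QuantumFieldTheory.Balaban1983to89.T4EtaRateCoeffDefect (pull pull_apply blockAvg fibre mem_fibre)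
open Literature.MathematicalPhysics.QuantumFieldTheory.Balaban1983to89.B6Prop26Gluing (mulOp mulOp_apply)
open Literature.MathematicalPhysics.QuantumFieldTheory.Balaban1983to89.B5Prop11Plancherel (Tor fine unitVec)
open Literature.MathematicalPhysics.QuantumFieldTheory.King1986 (aK)
open Literature.MathematicalPhysics.QuantumFieldTheory.King1986.Torus (fineOp lapF blockProj blockOf tdistT tdistT_nonneg tdistT_symm tdistT_le_of_coord circAbs_le_tdistT val_blockOf)
open Literature.MathematicalPhysics.QuantumFieldTheory.Balaban1983to89.B4TorusKernel.MultiPeriod (circAbs)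
open Literature.MathematicalPhysics.QuantumFieldTheory.Balaban1983to89.B6UnitTorusCarrier (unitTorusGeo)
open Summit.QuantumFields.YangMills.BalabanUVNodes.N15.VectorPiece (kingPr kingPrV kingPr_val blkFine tensorId tensorId_apply)
open Summit.QuantumFields.YangMills.BalabanUVNodes.N15.TwoGrid (torRefl torNeg torRefl_torRefl torRefl_apply_same torRefl_apply_ne torRefl_add torRefl_sub torRefl_injective
  torRefl_bijective torNeg_apply_same torNeg_apply_ne torRefl_add_unitVec_same torRefl_sub_unitVec_same torRefl_add_unitVec_ne torRefl_sub_unitVec_ne sum_torRefl)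
open Summit.QuantumFields.YangMills.BalabanUVNodes.N15KingModelRung.Curved (kingGOp kingSOp kingGOp_apply kingSOp_apply)

variable {d : ℕ} (L : ℕ)

/-! ## §1 The reflection commutes with every floor map: blocks, King's pairing; it is an isometry of the block torus -/

section Floor

variable {A B : Fin (d + 1) → ℕ} [∀ μ, NeZero (A μ)] [∀ μ, NeZero (B μ)] (κ : Fin (d + 1))

/-- `val (σx)_κ = N_κ − 1 − val x_κ`. [folklore] -/
theorem val_torRefl_same (x : Tor A) : ((torRefl A κ x) κ).val = A κ - 1 - (x κ).val := by
  rw [torRefl_apply_same]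
  have hlt : (x κ).val < A κ := ZMod.val_lt (x κ)
  have hA : 1 ≤ A κ := Nat.one_le_iff_ne_zero.mpr (NeZero.ne _)
  have hcast : (-1 - x κ : ZMod (A κ)) = ((A κ - 1 - (x κ).val : ℕ) : ZMod (A κ)) := by
    rw [Nat.cast_sub (by omega), Nat.cast_sub hA, ZMod.natCast_self, ZMod.natCast_zmod_val, Nat.cast_one]
    ring
  rw [hcast, ZMod.val_natCast, Nat.mod_eq_of_lt (by omega)]

omit [∀ μ, NeZero (A μ)] [∀ μ, NeZero (B μ)] in
/-- The floor arithmetic of the reflection: `(R·b − 1 − a) ∕ R = b − 1 − a ∕ R` for `a < R·b`. [folklore] -/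
theorem refl_div_arith {R b a : ℕ} (hR : 0 < R) (ha : a < R * b) : (R * b - 1 - a) / R = b - 1 - a / R := by
  obtain ⟨q, r, hr, rfl⟩ : ∃ q r, r < R ∧ a = q * R + r := ⟨a / R, a % R, Nat.mod_lt a hR, (Nat.div_add_mod' a R).symm⟩
  have hq : q < b := by
    by_contra h
    have h' : b ≤ q := Nat.le_of_not_lt h
    have : R * b ≤ q * R + r := by nlinarith
    omega
  have h1 : (q * R + r) / R = q := by
    rw [Nat.add_comm, Nat.add_mul_div_right _ _ hR, Nat.div_eq_of_lt hr, Nat.zero_add]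
  obtain ⟨t, rfl⟩ := Nat.exists_eq_add_of_lt hq
  obtain ⟨s, hs⟩ := Nat.exists_eq_add_of_lt hr
  have h2 : R * (q + t + 1) - 1 - (q * R + r) = t * R + s := by
    rw [Nat.sub_sub]
    refine Nat.sub_eq_of_eq_add ?_
    rw [hs]
    ring
  rw [h1, h2, Nat.add_comm, Nat.add_mul_div_right _ _ hR, Nat.div_eq_of_lt (by omega), Nat.zero_add]
  omega

/-- ★ **EVERY FLOOR MAP COMMUTES WITH THE REFLECTION**: if `φ : T_A → T_B` is `x ↦ ⌊x∕R⌋` coordinatewise (`A_μ = R·B_μ`) then `φ(σx) = σ(φx)` — blocks go to blocks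
(dag-n15-a N-Ia `torRefl_bpt`, read through the `val` characterisation). [folklore] -/
theorem floorMap_torRefl {R : ℕ} (hR : 0 < R) (φ : Tor A → Tor B) (hφ : ∀ x μ, (φ x μ).val = (x μ).val / R) (hAB : ∀ μ, A μ = R * B μ) (x : Tor A) :
    φ (torRefl A κ x) = torRefl B κ (φ x) := by
  funext μ
  apply ZMod.val_injective
  by_cases h : μ = κ
  · subst h
    have hgen : ∀ v : ℕ, v < A μ → (A μ - 1 - v) / R = B μ - 1 - v / R := fun v hv => by
      rw [hAB μ] at hv ⊢
      exact refl_div_arith hR hv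
    rw [hφ, val_torRefl_same, val_torRefl_same, hφ]
    exact hgen _ (ZMod.val_lt _)
  · rw [hφ, torRefl_apply_ne _ h, torRefl_apply_ne _ h, hφ]

end Floor

section KingMaps

variable (N : ℕ) [NeZero N] (M : Fin (d + 1) → ℕ) [∀ μ, NeZero (M μ)] (κ : Fin (d + 1))

omit L in
/-- King's unit blocks go to unit blocks: `B(σx) = σ̄(B(x))`. [cite: King1986, p.664 (blocks B^k(x))] -/
theorem blockOf_torRefl (x : Tor (fine N M)) : blockOf N M (torRefl (fine N M) κ x) = torRefl M κ (blockOf N M x) :=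
  floorMap_torRefl κ (Nat.pos_of_ne_zero (NeZero.ne N)) (blockOf N M) (fun x μ => val_blockOf x μ) (fun _ => rfl) x

variable [NeZero L]

/-- King's pairing commutes with the reflection: `pr(σ′x′) = σ(pr x′)`. [cite: King1986, p.664 (pairing convention)] -/
theorem kingPr_torRefl (K n : ℕ) (x' : Tor (fine (L ^ n * L ^ K) M)) :
    kingPr L K n M (torRefl (fine (L ^ n * L ^ K) M) κ x') = torRefl (fine (L ^ K) M) κ (kingPr L K n M x') :=
  floorMap_torRefl κ (pow_pos (Nat.pos_of_ne_zero (NeZero.ne L)) n) (kingPr L K n M) (fun x μ => kingPr_val L K n M x μ)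
    (fun μ => by show L ^ n * L ^ K * M μ = L ^ n * (L ^ K * M μ); ring) x'

/-- … and so does the coloured pairing `kingPrV` with the coloured reflections `(x, i) ↦ (σx, i)`. [folklore] -/
theorem kingPrV_reflC (K n : ℕ) :
    kingPrV L K n M ∘ (fun p : Tor (fine (L ^ n * L ^ K) M) × Fin (d + 1) => (torRefl (fine (L ^ n * L ^ K) M) κ p.1, p.2))
      = (fun q : Tor (fine (L ^ K) M) × Fin (d + 1) => (torRefl (fine (L ^ K) M) κ q.1, q.2)) ∘ kingPrV L K n M := by
  funext p
  simp only [Function.comp_apply, kingPrV, kingPr_torRefl]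

omit L [NeZero N] in
/-- The reflection is an isometry of King's block torus: `|σy − σy′|_T = |y − y′|_T` (coordinate `κ`: `(M−1−a) − (M−1−a′) = a′ − a`). [folklore] -/
theorem tdistT_torRefl (y y' : Tor M) : tdistT M (torRefl M κ y) (torRefl M κ y') = tdistT M y y' := by
  have key : ∀ y y' : Tor M, tdistT M (torRefl M κ y) (torRefl M κ y') ≤ tdistT M y y' := fun y y' => by
    obtain ⟨t, ht⟩ : ∃ n : ℕ, tdistT M y y' = n := ⟨_, rfl⟩
    rw [ht]
    refine tdistT_le_of_coord M _ _ t fun μ => ?_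
    by_cases h : μ = κ
    · subst h
      have ha : (y μ).val < M μ := ZMod.val_lt _
      have ha' : (y' μ).val < M μ := ZMod.val_lt _
      have e : (((torRefl M μ y) μ).val : ℤ) - (((torRefl M μ y') μ).val : ℤ) = ((y' μ).val : ℤ) - ((y μ).val : ℤ) := by
        rw [val_torRefl_same, val_torRefl_same]; omega
      rw [e]
      have h1 := circAbs_le_tdistT M y' y μ
      rw [tdistT_symm, ht] at h1
      exact_mod_cast h1
    · rw [torRefl_apply_ne _ h, torRefl_apply_ne _ h]
      have h1 := circAbs_le_tdistT M y y' μ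
      rw [ht] at h1
      exact_mod_cast h1
  refine le_antisymm (key y y') ?_
  have h := key (torRefl M κ y) (torRefl M κ y')
  rwa [torRefl_torRefl, torRefl_torRefl] at h

end KingMaps

/-! ## §2 `A₀` is reflection-invariant; `σ∘A₀⁻¹∘σ = A₀⁻¹`, `σ_κ∘(A₀⁻¹N∇*_κ)∘σ_κ = A₀⁻¹N∇_κ` -/

section Operators

variable {K : Fin (d + 1) → ℕ} [∀ μ, NeZero (K μ)] (κ : Fin (d + 1))

omit L [∀ μ, NeZero (K μ)] in
/-- The nearest-neighbour stencil is `σ`-symmetric: `(c(−Δ) + m²)(σx, σy) = (c(−Δ) + m²)(x, y)` (in direction `κ` the two neighbours swap). [cite: King1986, (4.4) p.670] -/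
theorem lapF_torRefl (c m2 : ℝ) (x y : Tor K) : lapF K c m2 (torRefl K κ x) (torRefl K κ y) = lapF K c m2 x y := by
  unfold lapF
  have h1 : (torRefl K κ y = torRefl K κ x) ↔ (y = x) := torRefl_injective.eq_iff
  have h2 : ∀ μ, ((if torRefl K κ y = torRefl K κ x + unitVec K μ then (1 : ℝ) else 0) + (if torRefl K κ y = torRefl K κ x - unitVec K μ then 1 else 0))
      = ((if y = x + unitVec K μ then (1 : ℝ) else 0) + (if y = x - unitVec K μ then 1 else 0)) := by
    intro μ
    by_cases h : μ = κ
    · subst h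
      rw [← torRefl_sub_unitVec_same, ← torRefl_add_unitVec_same]
      simp only [torRefl_injective.eq_iff]
      rw [add_comm]
    · rw [← torRefl_add_unitVec_ne _ h, ← torRefl_sub_unitVec_ne _ h]
      simp only [torRefl_injective.eq_iff]
  simp only [h1, h2]

variable (N : ℕ) [NeZero N] (M : Fin (d + 1) → ℕ) [∀ μ, NeZero (M μ)]

omit L in
/-- `Q*Q` sees only «same block», and blocks go to blocks: `(Q*Q)(σx, σy) = (Q*Q)(x, y)`. [cite: King1986, (2.10) p.652] -/
theorem blockProj_torRefl (x y : Tor (fine N M)) : blockProj N M (torRefl (fine N M) κ x) (torRefl (fine N M) κ y) = blockProj N M x y := by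
  simp only [blockProj, blockOf_torRefl, torRefl_injective.eq_iff]

/-- **`A₀` IS REFLECTION-INVARIANT**: `A₀(σx, σy) = A₀(x, y)` for King's `A₀ = c(−Δ) + m² + a·Q*Q`. [cite: King1986, (4.1)–(4.5) p.670] -/
theorem fineOp_torRefl (a c m2 : ℝ) (x y : Tor (fine N M)) :
    fineOp N M a c m2 (torRefl (fine N M) κ x) (torRefl (fine N M) κ y) = fineOp N M a c m2 x y := by
  simp only [fineOp, Matrix.add_apply, Matrix.smul_apply, lapF_torRefl, blockProj_torRefl]

/-- … as a statement about the reindexed matrix: `A₀.submatrix σ σ = A₀`. [folklore] -/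
theorem fineOp_submatrix_torRefl (a c m2 : ℝ) :
    (fineOp N M a c m2).submatrix (torRefl (fine N M) κ) (torRefl (fine N M) κ) = fineOp N M a c m2 := by
  ext x y
  exact fineOp_torRefl κ N M a c m2 x y

/-- … hence `A₀⁻¹.submatrix σ σ = A₀⁻¹` (reindexing by a permutation commutes with the inverse). [folklore] -/
theorem fineOp_inv_submatrix_torRefl (a c m2 : ℝ) :
    (fineOp N M a c m2)⁻¹.submatrix (torRefl (fine N M) κ) (torRefl (fine N M) κ) = (fineOp N M a c m2)⁻¹ := by
  have h := Matrix.inv_submatrix_equiv (fineOp N M a c m2) (Function.Involutive.toPerm (torRefl (fine N M) κ) torRefl_torRefl)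
    (Function.Involutive.toPerm (torRefl (fine N M) κ) torRefl_torRefl)
  have hcoe : ⇑(Function.Involutive.toPerm (torRefl (fine N M) κ) torRefl_torRefl) = torRefl (fine N M) κ := rfl
  rw [hcoe, fineOp_submatrix_torRefl] at h
  exact h.symm

/-- CONJUGATING A MATRIX OPERATOR BY THE REFLECTION reindexes the matrix: `σ∘(A·)∘σ = (A.submatrix σ σ)·`. [folklore] -/
theorem pull_torRefl_comp_mulVecLin_comp (A : Matrix (Tor (fine N M)) (Tor (fine N M)) ℝ) :
    pull (torRefl (fine N M) κ) ∘ₗ Matrix.mulVecLin A ∘ₗ pull (torRefl (fine N M) κ)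
      = Matrix.mulVecLin (A.submatrix (torRefl (fine N M) κ) (torRefl (fine N M) κ)) := by
  refine LinearMap.ext fun f => funext fun x => ?_
  have h := Matrix.submatrix_mulVec_equiv A f (torRefl (fine N M) κ) (Function.Involutive.toPerm (torRefl (fine N M) κ) torRefl_torRefl)
  have hcoe : ⇑(Function.Involutive.toPerm (torRefl (fine N M) κ) torRefl_torRefl) = torRefl (fine N M) κ := rfl
  have hsymm : ⇑(Function.Involutive.toPerm (torRefl (fine N M) κ) torRefl_torRefl).symm = torRefl (fine N M) κ := rfl
  rw [hcoe, hsymm] at h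
  rw [Matrix.mulVecLin_apply, h]
  rfl

/-- **`σ∘A₀⁻¹∘σ = A₀⁻¹`** (King's propagator commutes with the block-face reflection). [cite: King1986, (4.1)–(4.5) p.670; Balaban1984PropagatorsII, (2.37) p.229 (reflections)] -/
theorem pull_torRefl_comp_kingGOp_comp (a msq : ℝ) (Kl : ℕ) :
    pull (torRefl (fine N M) κ) ∘ₗ kingGOp L a msq Kl N M ∘ₗ pull (torRefl (fine N M) κ) = kingGOp L a msq Kl N M := by
  rw [kingGOp, pull_torRefl_comp_mulVecLin_comp, fineOp_inv_submatrix_torRefl]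

omit [NeZero N] [∀ μ, NeZero (M μ)] in
/-- The source shift conjugated: `σ_κ∘(s_κ⁻¹·)∘σ_κ = (s_κ·)` — `σ(σx − e_κ) = x + e_κ`. [folklore] -/
theorem pull_torRefl_comp_pull_sub_comp :
    pull (torRefl (fine N M) κ) ∘ₗ pull (fun y : Tor (fine N M) => y - unitVec (fine N M) κ) ∘ₗ pull (torRefl (fine N M) κ)
      = pull (fun y : Tor (fine N M) => y + unitVec (fine N M) κ) := by
  refine LinearMap.ext fun f => funext fun x => ?_
  simp only [LinearMap.comp_apply, pull_apply]
  rw [torRefl_sub_unitVec_same, torRefl_torRefl]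

/-- Entrywise: `A₀⁻¹(σx, σy) = A₀⁻¹(x, y)`. [folklore] -/
theorem fineOp_inv_torRefl (a c m2 : ℝ) (x y : Tor (fine N M)) :
    (fineOp N M a c m2)⁻¹ (torRefl (fine N M) κ x) (torRefl (fine N M) κ y) = (fineOp N M a c m2)⁻¹ x y := by
  have h := fineOp_inv_submatrix_torRefl κ N M a c m2
  exact congr_fun (congr_fun h x) y

/-- ★ **`σ_κ∘(A₀⁻¹N∇*_κ)∘σ_κ = A₀⁻¹N∇_κ`**: the rung's third-entry operator `kingSOp_κ = A₀⁻¹∘N(s_κ⁻¹ − 1)` conjugated by the block-face reflection in ITS OWN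
direction is the FORWARD source difference `S̃_κ = A₀⁻¹∘N(s_κ − 1)` of programme Y's by-parts fixed point. [cite: Balaban1985BackgroundPropagators, (3.42) p.397 (third
entry, shape); King1986, (4.1)–(4.5) p.670] -/
theorem pull_torRefl_comp_kingSOp_comp (a msq : ℝ) (Kl : ℕ) :
    pull (torRefl (fine N M) κ) ∘ₗ kingSOp L a msq Kl N M κ ∘ₗ pull (torRefl (fine N M) κ)
      = kingGOp L a msq Kl N M ∘ₗ ((N : ℝ) • (pull (fun y : Tor (fine N M) => y + unitVec (fine N M) κ) - LinearMap.id)) := by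
  refine LinearMap.ext fun f => funext fun x => ?_
  rw [LinearMap.comp_apply, LinearMap.comp_apply, pull_apply, kingSOp_apply, LinearMap.comp_apply, kingGOp_apply]
  simp only [Matrix.mulVec, dotProduct, pull_apply, LinearMap.smul_apply, LinearMap.sub_apply, Pi.smul_apply, Pi.sub_apply, LinearMap.id_apply, smul_eq_mul]
  rw [← sum_torRefl (κ := κ) (fun z => (fineOp N M (aK a L Kl) (((N : ℕ) : ℝ) ^ 2) msq)⁻¹ (torRefl (fine N M) κ x) z *
    ((N : ℝ) * (f (torRefl (fine N M) κ (z - unitVec (fine N M) κ)) - f (torRefl (fine N M) κ z))))]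
  refine Finset.sum_congr rfl fun z _ => ?_
  simp only [fineOp_inv_torRefl, torRefl_sub_unitVec_same, torRefl_torRefl]

omit [NeZero N] [∀ μ, NeZero (M μ)] in
/-- THE COLOURED REFLECTION `(x, i) ↦ (σx, i)` CONJUGATING A LIFT is the lift of the conjugated operator. [folklore] -/
theorem reflC_comp_tensorId_comp (T : (Tor (fine N M) → ℝ) →ₗ[ℝ] (Tor (fine N M) → ℝ)) :
    pull (fun p : Tor (fine N M) × Fin (d + 1) => (torRefl (fine N M) κ p.1, p.2)) ∘ₗ tensorId (Fin (d + 1)) T ∘ₗ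
        pull (fun p : Tor (fine N M) × Fin (d + 1) => (torRefl (fine N M) κ p.1, p.2))
      = tensorId (Fin (d + 1)) (pull (torRefl (fine N M) κ) ∘ₗ T ∘ₗ pull (torRefl (fine N M) κ)) :=
  LinearMap.ext fun _ => funext fun _ => rfl

/-- ★ **THE COLOURED CONJUGATE OF THE THIRD-ENTRY LIFT**: `σ_κ∘(kingSOp_κ ⊗ 1)∘σ_κ = (A₀⁻¹N∇_κ) ⊗ 1`. [folklore] -/
theorem reflC_comp_tensorId_kingSOp_comp (a msq : ℝ) (Kl : ℕ) :
    pull (fun p : Tor (fine N M) × Fin (d + 1) => (torRefl (fine N M) κ p.1, p.2)) ∘ₗ tensorId (Fin (d + 1)) (kingSOp L a msq Kl N M κ) ∘ₗ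
        pull (fun p : Tor (fine N M) × Fin (d + 1) => (torRefl (fine N M) κ p.1, p.2))
      = tensorId (Fin (d + 1)) (kingGOp L a msq Kl N M ∘ₗ ((N : ℝ) • (pull (fun y : Tor (fine N M) => y + unitVec (fine N M) κ) - LinearMap.id))) := by
  rw [reflC_comp_tensorId_comp, pull_torRefl_comp_kingSOp_comp]

end Operators

/-! ## §3 ★★ Block majorants and η-defects are transported by conjugation with block-compatible reflections -/

section Transport

variable {L} {g : B6.Geometry} {X₁ X₂ : Type} [Fintype X₁] [Fintype X₂]

/-- ★★ **CONJUGATION BY BLOCK-COMPATIBLE INVOLUTIONS KEEPS A BLOCK MAJORANT.**  Let `φ₁, φ₂` be involutions of two lattices over the site set of `g`, `ψ` an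
involution of the sites with `blk_i(φ_i x) = ψ(blk_i x)` (blocks go to blocks) and `K(ψy, ψy′) = K(y, y′)` (`K ≥ 0`; e.g. `ψ` an isometry and `K` a function of the
distance).  If `T` has the block majorant `K` between the sharp block sizes, so does `φ₂^*∘T∘φ₁^*` (`φ^* f = f∘φ`): the block of `ψy′` is carried onto the block of
`y′`. [folklore] -/
theorem hasMaj_reflConj {blk₁ : X₁ → g.Site} {blk₂ : X₂ → g.Site} {φ₁ : X₁ → X₁} {φ₂ : X₂ → X₂} {ψ : g.Site → g.Site}
    (hψ : Function.Involutive ψ) (hb₁ : ∀ x, blk₁ (φ₁ x) = ψ (blk₁ x)) (hb₂ : ∀ x, blk₂ (φ₂ x) = ψ (blk₂ x))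
    {T : (X₁ → ℝ) →ₗ[ℝ] (X₂ → ℝ)} {K : g.Site → g.Site → ℝ} (hK0 : ∀ y y', 0 ≤ K y y') (hK : ∀ y y', K (ψ y) (ψ y') = K y y')
    (hT : HasMaj (BlockNorm.ofBlocks g blk₁) (BlockNorm.ofBlocks g blk₂) T K) :
    HasMaj (BlockNorm.ofBlocks g blk₁) (BlockNorm.ofBlocks g blk₂) (pull φ₂ ∘ₗ T ∘ₗ pull φ₁) K := by
  intro y' μ hμ y
  have hμ0 : ∀ x, blk₁ x ≠ y' → μ x = 0 := hμ
  -- `μ∘φ₁` is localised in the block `ψy′`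
  have hμ' : (BlockNorm.ofBlocks g blk₁).IsLoc (ψ y') (pull φ₁ μ) := by
    intro x hx
    rw [pull_apply]
    refine hμ0 (φ₁ x) fun h => hx ?_
    rw [← h, hb₁]
    exact (hψ (blk₁ x)).symm
  have h := hT (ψ y') (pull φ₁ μ) hμ' (ψ y)
  rw [hK] at h
  have hL1 : (BlockNorm.ofBlocks g blk₁).loc (ψ y') (pull φ₁ μ) ≤ (BlockNorm.ofBlocks g blk₁).loc y' μ := by
    refine loc_ofBlocks_le blk₁ _ ((BlockNorm.ofBlocks g blk₁).loc_nonneg y' μ) fun x hx => ?_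
    rw [pull_apply]
    exact abs_le_loc_ofBlocks blk₁ μ (by rw [hb₁, hx, hψ y'])
  have hL0 := (BlockNorm.ofBlocks g blk₂).loc_nonneg (ψ y) (T (pull φ₁ μ))
  refine loc_ofBlocks_le blk₂ _ (mul_nonneg (hK0 y y') ((BlockNorm.ofBlocks g blk₁).loc_nonneg y' μ)) fun x hx => ?_
  rw [LinearMap.comp_apply, LinearMap.comp_apply, pull_apply]
  exact (abs_le_loc_ofBlocks blk₂ (T (pull φ₁ μ)) (by rw [hb₂, hx])).trans (h.trans (mul_le_mul_of_nonneg_left hL1 (hK0 y y')))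

variable {X₁' X₂' : Type}

omit [Fintype X₁] [Fintype X₂] in
/-- THE η-DEFECT OF TWO CONJUGATES IS THE CONJUGATE OF THE η-DEFECT when the pairings intertwine the reflections (`π₁∘φ₁′ = φ₁∘π₁`, `π₂∘φ₂′ = φ₂∘π₂`):
`𝔇_{π₁,π₂}(φ₂′^*A′φ₁′^*, φ₂^*Āφ₁^*) = φ₂′^*∘𝔇_{π₁,π₂}(A′, Ā)∘φ₁^*`. [folklore] -/
theorem idef_reflConj {π₁ : X₁' → X₁} {π₂ : X₂' → X₂} {φ₁ : X₁ → X₁} {φ₂ : X₂ → X₂} {φ₁' : X₁' → X₁'} {φ₂' : X₂' → X₂'}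
    (h₁ : ∀ x', π₁ (φ₁' x') = φ₁ (π₁ x')) (h₂ : ∀ x', π₂ (φ₂' x') = φ₂ (π₂ x'))
    (A' : (X₁' → ℝ) →ₗ[ℝ] (X₂' → ℝ)) (A : (X₁ → ℝ) →ₗ[ℝ] (X₂ → ℝ)) :
    idef (pull π₁) (pull π₂) (pull φ₂' ∘ₗ A' ∘ₗ pull φ₁') (pull φ₂ ∘ₗ A ∘ₗ pull φ₁)
      = pull φ₂' ∘ₗ idef (pull π₁) (pull π₂) A' A ∘ₗ pull φ₁ := by
  refine LinearMap.ext fun f => funext fun x' => ?_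
  simp only [idef_apply, LinearMap.comp_apply, Pi.sub_apply, pull_apply]
  have e1 : (pull φ₁' (pull π₁ f)) = pull π₁ (pull φ₁ f) := by
    funext z; simp only [pull_apply, h₁]
  rw [e1, ← h₂]

omit [Fintype X₁] [Fintype X₂] in
/-- PULLING A MULTIPLIER BACK: `φ^*∘M_c = M_{c∘φ}∘φ^*`. [folklore] -/
theorem pull_comp_mulOp (φ : X₁ → X₁) (c : X₁ → ℝ) : pull φ ∘ₗ mulOp c = mulOp (c ∘ φ) ∘ₗ pull φ :=
  LinearMap.ext fun _ => funext fun _ => rfl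

omit [Fintype X₁] [Fintype X₂] in
/-- **THE BLOCK AVERAGE COMMUTES WITH THE REFLECTIONS**: if `π∘φ′ = φ∘π` with `φ, φ′` involutions, then `blockAvg_π(c′∘φ′) = (blockAvg_π c′)∘φ` — `φ′` carries the
fibre of `x` onto the fibre of `φx`. [folklore] -/
theorem blockAvg_comp_refl [Fintype X₁'] [DecidableEq X₁] {π : X₁' → X₁} {φ : X₁ → X₁} {φ' : X₁' → X₁'} (hφ : Function.Involutive φ)
    (hφ' : Function.Involutive φ') (h : ∀ x', π (φ' x') = φ (π x')) (c' : X₁' → ℝ) : blockAvg π (c' ∘ φ') = blockAvg π c' ∘ φ := by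
  classical
  funext x
  simp only [blockAvg, Function.comp_apply]
  have hmem : ∀ x' ∈ fibre π x, φ' x' ∈ fibre π (φ x) := fun x' hx' => by
    rw [mem_fibre] at hx' ⊢; rw [h, hx']
  have hmem' : ∀ y' ∈ fibre π (φ x), φ' y' ∈ fibre π x := fun y' hy' => by
    rw [mem_fibre] at hy' ⊢; rw [h, hy', hφ x]
  rw [Finset.sum_nbij' φ' φ' hmem hmem' (fun a _ => hφ' a) (fun a _ => hφ' a) (fun a _ => rfl),
    Finset.card_nbij' φ' φ' hmem hmem' (fun a _ => hφ' a) (fun a _ => hφ' a)]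

omit [Fintype X₁] [Fintype X₂] in
/-- **THE COEFFICIENT DEFECT UNDER THE REFLECTIONS**: `φ′^*∘𝔇_π(M_{c′}, M_{c̄}) = 𝔇_π(M_{c′∘φ′}, M_{c̄∘φ})∘φ^*` when `π∘φ′ = φ∘π`. [folklore] -/
theorem pull_comp_idef_mulOp {π : X₁' → X₁} {φ : X₁ → X₁} {φ' : X₁' → X₁'} (h : ∀ x', π (φ' x') = φ (π x')) (c' : X₁' → ℝ) (c : X₁ → ℝ) :
    pull φ' ∘ₗ idef (pull π) (pull π) (mulOp c') (mulOp c) = idef (pull π) (pull π) (mulOp (c' ∘ φ')) (mulOp (c ∘ φ)) ∘ₗ pull φ := by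
  refine LinearMap.ext fun f => funext fun x' => ?_
  simp only [idef_apply, LinearMap.comp_apply, Pi.sub_apply, pull_apply, mulOp_apply, Function.comp_apply, h]

end Transport

end Summit.QuantumFields.YangMills.BalabanUVNodes.N15.KingModel.SrcDiv
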